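import Summits.ValiantsHypothesis.ValiantsHypothesis.Theses.BorderApolarity
import Literature.Computability.AlgebraicComplexity.DeterminantalComplexity
import Literature.Computability.AlgebraicComplexity.DeterminantalComplexityProofs
import Literature.Computability.AlgebraicComplexity.LinSubstProofs
import Literature.Computability.AlgebraicComplexity.VPDeterminantalQPProofs
import HarnessLib.Audit

/-!
# Line `toric-face-debordering` — skeleton for crux `BorderApolarity.FixedWitnessObstructionQP`
(item stmt-ValiantsHypothesis-5778, route route-ValiantsHypothesis-BorderApolarity; merged with idea
`fixed-point-debordering`; planner skeleton `Lines/toric-face-debordering.lean` @25ffab8ba89f, RESHAPED by the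
line lead prover-line-stmt-ValiantsHypothesis-5778-1 on 2026-08-16 — see "Reshape" below)

Idea (card `Cruxes/FixedWitnessObstructionQP/Ideas/toric-face-debordering.md`). A Borel-fixed
border-apolar witness `(P•, J)` at `(n, m)` is — at the level of FORMS, which is all the line needs —
a toric face restriction: `X₀₀^(m-n) per_n = u · F_e`, `F := g · det_m`, `F_e :=` the `w`-weighted
homogeneous component of `F` of weight `e` for some weight `w : {variables} → ℕ` (`stub_toricFace`, the
form-level shadow of crux 3 `ToricFixedPoints`; it follows from that route item and the registered, provable
SOCLE STEP `stub_socle` by the sorry-free `toricFace_of_toricFixedPoints`). A weighted component of a size-`s`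
determinant with weights `≤ B` is itself an HONEST determinant of size `poly(s · B)`: interpolate
`F(t^w x) = Σ_{e ≤ sB} t^e F_e(x)` at `sB + 1` nodes (`stub_interp`), each node a size-`s` determinant of affine
forms, hence an inverse read-out `vᵀ B⁻¹ w` of a unimodular affine matrix of size `poly(s)`
(`stub_invReprOfDetRepr`: Ikenmeyer–Landsberg power trace, PROVED in the tree, + the layered branching program),
and inverse read-outs ADD (`HasInvRepr.add`, tree) — assembled sorry-free here as `deborder` (the planner's
`stub_deborder`, now a theorem over the two registered stubs). Undo `u` (`hasDetRepr_linSubst`, proved here) and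
set `X₀₀ = 1` (`stub_unpad`, a projection): `dc(per_n) ≤ C ((m+1)(B+1))^e₀`. The NEW load-bearing statement
`stub_weightBound` says the weight can be taken of size `B ≤ 2^((log₂ m + c₁)^c₁)`; inside the crux's window the
loss is quasi-polynomial (`qp_absorb`, proved), so a witness forces `dc(per_n) ≤ 2^((log₂ n + c')^c')`,
contradicting the EVENTUAL affine hardness of the permanent `stub_dcPerEventuallySuperQP` — the EXTERNAL input
shared with route DetQP (eventual form of its thesis stmt-ValiantsHypothesis-0315), briefed to nobody.

## Reshape (lead, 2026-08-16; composition idea unchanged, 7 registered stubs = stubs_max)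
* `stub_deborder` (planner, L in Lean) ↦ `stub_interp` (Vandermonde interpolation of weighted components by torus
  substitutes) + `stub_invReprOfDetRepr` (homogeneous `HasDetRepr f s ⇒ HasInvRepr f (2(s+1)^9)`), with the
  sorry-free assembly `deborder` (constants `C = 3`, `e₀ = 10`) and the inline lemmas `hasDetRepr_linSubst`,
  `hasInvRepr_smul`.
* `stub_unpad` ↦ projection form: `HasDetRepr (paddedPerPoly ℂ n m) s → HasDetRepr (perPoly (Fin n) ℂ) s`
  (the `linSubst u` step moved into `FixedWitnessObstructionQP_of` via `hasDetRepr_linSubst`).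
* NEW registered `stub_socle` = the socle step (was the inline hypothesis `hS` of `toricFace_of_toricFixedPoints`).
* `stub_toricFace`, `stub_weightBound`, `stub_dcPerEventuallySuperQP`: signatures byte-identical to the planner's.

`FixedWitnessObstructionQP_of` (sorry-free) is the composition; sorries ONLY in the seven `stub_*` theorems.

Disproof.lean (cdisprove gen 2) obligations honoured exactly as in the planner's header: W1/W3 consumed inside
`stub_toricFace`/`stub_socle` (W5 used once, at `k = m`, `crux_iff_top`); Grenet control (`m = 2ⁿ - 1`: toric with
`B = 1`, no contradiction claimed below stub 5's threshold); padded-determinant control: stubs 1–4 and the socle step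
hold verbatim for `ℓ^(m-n) det_n` (B = 1) and output the TRUE `dc(det_n) ≤ poly(m)`; all per/det asymmetry is in stub 5.
-/

open scoped BigOperators Matrix

set_option linter.dupNamespace false
open Literature.Computability.AlgebraicComplexity

namespace Summit.ValiantsHypothesis.ValiantsHypothesis.Cruxes.FixedWitnessObstructionQP.ToricFaceDebordering

/-! ## Stubs (registered; `sorry` allowed only here) -/

/-- **Stub 1a — toric face normal form of a fixed witness (form level; structural, L).**
For `3 ≤ n ≤ m`, if a Borel-fixed border-apolar witness `(P•, J)` of the crux exists at `(n, m)`
(hypothesis = the crux's W1 ∧ W2 ∧ W3 ∧ W4 ∧ W5, VERBATIM the antecedent of the route's support item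
`WitnessToMembership`), then the padded permanent is a translate of a weighted-homogeneous component of
a translate of the determinant: `X₀₀^(m-n) per_n = u · wHC_w^e (g · det_m)` for some `u, g ∈ GL_{m²}`,
`w : (Fin m × Fin m) → ℕ`, `e : ℕ`.
Why plausibly true: it is implied by the route's crux 3 `ToricFixedPoints` (stmt-5779, ideal level:
`J = lim_t Ann(u · diag((t+2)^w) · g · det_m)`) plus the elementary socle step (`J_m` is a hyperplane
by W2+W3 and lies in the hyperplane `Ann_m(pp)` by W5, so `[u · Σ_e (t+2)^e F_e] → [pp]`, i.e.
`pp ∝ u · F_{e_max}`; absorb the scalar into `u` by an `m`-th root or by row scaling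
`Disproof.WTM.smul_mem_glOrbit_detPoly`; shift `w` to `ℕ`) — cf. `Disproof.crux_iff_top`: W5 is exactly this
ONE hyperplane condition, and the toolkit of `Disproof.lean` §7 (`apolarAction_eq_C`, `mem_of_L_eq_zero`,
`exists_smul_of_ker_le`) is the socle step's; it is strictly
WEAKER than 5779 (a non-saturated / iterated limit `J` whose degree-`m` socle is still a face restriction
satisfies it), as triage r1-2 (b) asked. It holds with 0/1 weights on `End(W) · det_m ∋ ℓ^(m-n) det_n`
and for Grenet's witnesses (`m ≥ 2ⁿ - 1`). Why it might fail: a genuinely iterated degeneration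
(`G((t)) = G[[t]] T((t)) G[[t]]`) whose limit form is not on one torus orbit closure of one translate.
Sources: card; LandsbergGCT2017 §6.7; HuttenhainLairez2016; BuczynskaBuczynski2021 Thm 1. -/
theorem stub_toricFace : ∀ (n m : ℕ) [NeZero m], 3 ≤ n → n ≤ m →
    (let act := fun (D f : MvPolynomial (Fin m × Fin m) ℂ) => ∑ e ∈ D.support, ∑ d ∈ f.support, MvPolynomial.monomial (d - e) (MvPolynomial.coeff e D * MvPolynomial.coeff d f * ∏ i ∈ e.support, (Nat.descFactorial (d i) (e i) : ℂ)); let rk := fun (p : Fin m × Fin m) => (if (m - n ≤ (p.1 : ℕ) ∧ m - n ≤ (p.2 : ℕ)) ∨ p = (0, 0) then 0 else m * m) + ((p.1 : ℕ) * m + (p.2 : ℕ)); (∃ (P : ℕ → MvPolynomial (Fin m × Fin m) ℂ) (J : ℕ → Set (MvPolynomial (Fin m × Fin m) ℂ)), (∀ t : ℕ, P t ∈ Literature.Computability.AlgebraicComplexity.glOrbit (Fin m × Fin m) ℂ (Literature.Computability.AlgebraicComplexity.detPoly (Fin m) ℂ)) ∧ (∀ k ≤ m, ∀ D ∈ J k,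 ∃ Ds : ℕ → MvPolynomial (Fin m × Fin m) ℂ, (∀ t, (Ds t).IsHomogeneous k ∧ act (Ds t) (P t) = 0) ∧ Filter.Tendsto (fun t => Literature.Computability.AlgebraicComplexity.coeffVec (Ds t)) Filter.atTop (nhds (Literature.Computability.AlgebraicComplexity.coeffVec D))) ∧ (∀ k ≤ m, ∀ (D : MvPolynomial (Fin m × Fin m) ℂ) (φ : ℕ → ℕ) (Ds : ℕ → MvPolynomial (Fin m × Fin m) ℂ), StrictMono φ → (∀ t, (Ds t).IsHomogeneous k ∧ act (Ds t) (P (φ t)) = 0) → Filter.Tendsto (fun t => Literature.Computability.AlgebraicComplexity.coeffVec (Ds t)) Filter.atTop (nhds (Literature.Computability.AlgebraicComplexity.coeffVec D)) → D ∈ J k) ∧ (∀ A : Matrix.GeneralLinearGroup (Fin m × Fin m) ℂ, let M : Matrix (Fin m × Fin m) (Fin m × Fin m) ℂ := A; (∀ i j : Fin m × Fin m, M j i ≠ 0 → rk j ≤ rk i) → (∀ i j : Fin m × Fin m, ((m - n ≤ (i.1 : ℕ) ∧ m - n ≤ (i.2 : ℕ)) ∨ i = (0, 0)) → j ≠ i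 → M j i = 0) → (∀ i k j l : Fin m, m - n ≤ (i : ℕ) → m - n ≤ (k : ℕ) → m - n ≤ (j : ℕ) → m - n ≤ (l : ℕ) → M (i, j) (i, j) * M (k, l) (k, l) = M (i, l) (i, l) * M (k, j) (k, j)) → M (0, 0) (0, 0) ^ (m - n) * ∏ i ∈ Finset.univ.filter (fun i : Fin m => m - n ≤ (i : ℕ)), M (i, i) (i, i) = 1 → ∀ k ≤ m, ∀ D ∈ J k, Literature.Computability.AlgebraicComplexity.linSubst (Fin m × Fin m) ℂ Mᵀ D ∈ J k) ∧ (∀ k ≤ m, ∀ D ∈ J k, act D (Literature.Computability.AlgebraicComplexity.paddedPerPoly ℂ n m) = 0))) →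
      ∃ (u g : Matrix.GeneralLinearGroup (Fin m × Fin m) ℂ) (w : Fin m × Fin m → ℕ) (e : ℕ),
        paddedPerPoly ℂ n m =
          linSubst (Fin m × Fin m) ℂ (u : Matrix (Fin m × Fin m) (Fin m × Fin m) ℂ)
            (MvPolynomial.weightedHomogeneousComponent w e
              (linSubst (Fin m × Fin m) ℂ (g : Matrix (Fin m × Fin m) (Fin m × Fin m) ℂ) (detPoly (Fin m) ℂ))) := by
  sorry

/-- **Stub 1b — the SOCLE STEP (elementary; M in mathematics, M/L in Lean; provable now).** If `J` is the
border-apolar limit (W2 ∧ W3, `k ≤ m`) of the TORIC family `Q_t = u · diag((t+2)^w) · g · det_m`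
(`w : variables → ℤ`; this is the conclusion of route item `ToricFixedPoints`, stmt-5779, verbatim) and
`J_k ⊆ Ann_k(pp)` for `k ≤ m` (W5), then the padded permanent is a translate of a weighted-homogeneous component
of a translate of the determinant, with ℕ-valued weights. Proof plan: `Q_t = Σ_e (t+2)^e · u·F_e`
(`F = g·det_m`, `F_e = wHC_w^e F`; `linSubst (diagonal a) (monomial d c) = (Π a_i^{d_i}) • monomial d c`), so
`(t+2)^{-e_max} Q_t → u·F_{e_max} =: Q_∞ ≠ 0` coefficientwise; every degree-`m` form `D` with `D ⌟ Q_∞ = 0` is a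
coefficientwise limit of degree-`m` annihilators of `Q_t` (Literature `BorderApolarity.mem_of_sum_eq_zero` with
`φ = id`, normalised weighted coefficient vectors of `Q_t` converge to that of `Q_∞`), hence lies in `J m` by W3;
so `Ann_m(Q_∞) ⊆ J m ⊆ Ann_m(pp)` (W5), and two hyperplanes of `S_m` in containment have proportional normals
(`BorderApolarity.exists_smul_of_sum_eq_zero_imp`, `apolarAction_eq_zero_iff_sum`, `paddedPerPoly_ne_zero`):
`pp = λ · u · F_{e_max} = u · wHC_w^{e_max}(λ F)`, `λ F = g' · det_m` (`BorderApolarity.smul_mem_glOrbit_detPoly`),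
and shifting `w` by a constant makes it ℕ-valued without changing the component (`F` homogeneous of degree `m`).
Only W3@m and W5@m are used. Sources: BuczynskaBuczynski2021 Thm 1 (necessity half, socle degree);
LandsbergGCT2017 §6.7; tree `BorderApolarityMembership.lean`. -/
theorem stub_socle : ∀ (n m : ℕ) [NeZero m], 3 ≤ n → n ≤ m → let act := fun (D f : MvPolynomial (Fin m × Fin m) ℂ) => ∑ e ∈ D.support, ∑ d ∈ f.support, MvPolynomial.monomial (d - e) (MvPolynomial.coeff e D * MvPolynomial.coeff d f * ∏ i ∈ e.support, (Nat.descFactorial (d i) (e i) : ℂ));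
    ∀ (J : ℕ → Set (MvPolynomial (Fin m × Fin m) ℂ)) (u g : Matrix.GeneralLinearGroup (Fin m × Fin m) ℂ)
      (w : Fin m × Fin m → ℤ),
      (let Q : ℕ → MvPolynomial (Fin m × Fin m) ℂ := fun t => Literature.Computability.AlgebraicComplexity.linSubst (Fin m × Fin m) ℂ (u : Matrix (Fin m × Fin m) (Fin m × Fin m) ℂ) (Literature.Computability.AlgebraicComplexity.linSubst (Fin m × Fin m) ℂ (Matrix.diagonal fun i : Fin m × Fin m => ((t : ℂ) + 2) ^ (w i)) (Literature.Computability.AlgebraicComplexity.linSubst (Fin m × Fin m) ℂ (g : Matrix (Fin m × Fin m) (Fin m × Fin m) ℂ) (Literature.Computability.AlgebraicComplexity.detPoly (Fin m) ℂ))); (∀ k ≤ m, ∀ D ∈ J k, ∃ Ds : ℕ → MvPolynomial (Fin m × Fin m) ℂ, (∀ t, (Ds t).IsHomogeneous k ∧ act (Ds t) (Q t) = 0) ∧ Filter.Tendsto (fun t => Literature.Computability.AlgebraicComplexity.coeffVec (Ds t)) Filter.atTop (nhds (Literature.Computability.AlgebraicComplexity.coeffVec D))) ∧ (∀ k ≤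 m, ∀ (D : MvPolynomial (Fin m × Fin m) ℂ) (φ : ℕ → ℕ) (Ds : ℕ → MvPolynomial (Fin m × Fin m) ℂ), StrictMono φ → (∀ t, (Ds t).IsHomogeneous k ∧ act (Ds t) (Q (φ t)) = 0) → Filter.Tendsto (fun t => Literature.Computability.AlgebraicComplexity.coeffVec (Ds t)) Filter.atTop (nhds (Literature.Computability.AlgebraicComplexity.coeffVec D)) → D ∈ J k)) →
      (∀ k ≤ m, ∀ D ∈ J k, act D (Literature.Computability.AlgebraicComplexity.paddedPerPoly ℂ n m) = 0) →
      ∃ (u g : Matrix.GeneralLinearGroup (Fin m × Fin m) ℂ) (w : Fin m × Fin m → ℕ) (e : ℕ),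
        paddedPerPoly ℂ n m =
          linSubst (Fin m × Fin m) ℂ (u : Matrix (Fin m × Fin m) (Fin m × Fin m) ℂ)
            (MvPolynomial.weightedHomogeneousComponent w e
              (linSubst (Fin m × Fin m) ℂ (g : Matrix (Fin m × Fin m) (Fin m × Fin m) ℂ) (detPoly (Fin m) ℂ))) := by
  sorry

/-- **Stub 2 — `WeightBoundQP`: quasi-polynomial face normals (polyhedral; the NEW load-bearing
statement, XL).** There is an absolute `c₁` such that whenever the padded permanent `X₀₀^(m-n) per_n`
(`3 ≤ n ≤ m`) is a translate of SOME weighted component `u · wHC_w^e(g · det_m)`, it is one with all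
weights `w i ≤ 2^((log₂ m + c₁)^c₁)` (possibly for other `u, g, e`).
Why plausibly true: the order of approximation along a ONE-parameter torus degeneration is polyhedral —
the size of an integer functional exposing a face of the lattice polytope `New(g · det_m) ⊂ m · Δ_{m²-1}`
— not analytic; spread `0` is `End(W) · det_m`, the known genuinely-border components (`P_Λ`,
HuttenhainLairez2016 / LandsbergGCT2017 Prop 6.7.2.2) have spread `O(1)`; no family with provably
super-polynomial toric approximation order is known (DGIJL arXiv:2211.07055 p. 4/6; tree
`ApproximationOrderBound.lean`: only the general LL89 exponential bound). Why it might fail (honest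
adversary, uncatalogued): Alon–Vũ — generic 0/1-polytopes in `ℝ^d`, `d = m²`, have facets needing
coefficients `(d-1)^((d-1)/2) / 2^(2d+o(d))` (Ziegler math/9909177 Thm 25 / Cor 26); the proof must use
that the permanent-carrying face is `T'`-isotypic with an `n!`-term `S_n × S_n`-symmetric support.
Reshape allowed if refuted at fixed `m`: let the size grow, `∃ m' ≤ 2^((log₂ m + c₁)^c₁)` with
`pp_{n,m'}` a bounded-weight component at size `m'` — still sufficient for `FixedWitnessObstructionQP_of`.
Sources: card; arXiv:1812.06828 §5; arXiv:2211.07055; arXiv:math/9909177. -/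
theorem stub_weightBound : ∃ c₁ : ℕ, ∀ (n m : ℕ) [NeZero m], 3 ≤ n → n ≤ m →
    (∃ (u g : Matrix.GeneralLinearGroup (Fin m × Fin m) ℂ) (w : Fin m × Fin m → ℕ) (e : ℕ),
        paddedPerPoly ℂ n m =
          linSubst (Fin m × Fin m) ℂ (u : Matrix (Fin m × Fin m) (Fin m × Fin m) ℂ)
            (MvPolynomial.weightedHomogeneousComponent w e
              (linSubst (Fin m × Fin m) ℂ (g : Matrix (Fin m × Fin m) (Fin m × Fin m) ℂ) (detPoly (Fin m) ℂ)))) →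
      ∃ (u g : Matrix.GeneralLinearGroup (Fin m × Fin m) ℂ) (w : Fin m × Fin m → ℕ) (e : ℕ),
        (∀ i, w i ≤ 2 ^ ((Nat.log 2 m + c₁) ^ c₁)) ∧
        paddedPerPoly ℂ n m =
          linSubst (Fin m × Fin m) ℂ (u : Matrix (Fin m × Fin m) (Fin m × Fin m) ℂ)
            (MvPolynomial.weightedHomogeneousComponent w e
              (linSubst (Fin m × Fin m) ℂ (g : Matrix (Fin m × Fin m) (Fin m × Fin m) ℂ) (detPoly (Fin m) ℂ))) := by
  sorry

/-- **Stub 3a — interpolation of weighted-homogeneous components by torus substitutes (elementary, M;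
provable now).** If every monomial of `f` has `w`-weight `≤ N`, then for every `e` the weight-`e` component
`wHC_w^e f` is a `ℂ`-linear combination of the `N + 1` torus substitutes `f(… (j+1)^{w_i} x_i …)`, `j = 0..N`:
`linSubst (diagonal (s^{w}))` scales the weight-`v` component by `s^v` (`linSubst_X`: `X_i ↦ s^{w_i} X_i`), so
`P(s) := linSubst (diagonal s^w) f = Σ_{v ≤ N} s^v · wHC_w^v f` and the Vandermonde matrix at the distinct nodes
`1, …, N+1` is invertible (`Matrix.det_vandermonde`, `Matrix.vandermonde`, `Finset.prod_ne_zero_iff`); for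
`e > N` the component is `0` (all coefficients `c = 0`). Leans on: Mathlib `MvPolynomial.weightedHomogeneousComponent`,
`coeff_weightedHomogeneousComponent`, `sum_weightedHomogeneousComponent`, `Finsupp.weight`, `Matrix.vandermonde`,
`Matrix.det_vandermonde_ne_zero_iff`/`Matrix.mulVec_cramer`/`Matrix.nonsing_inv_mul`, tree `linSubst_X`, `linSubst_C`.
[folklore; Bürgisser 2004 (arXiv:cs/0212057) Lemma 5.5(3) / Strassen's homogenisation trick] -/
theorem stub_interp : ∀ (σ : Type) [Fintype σ] [DecidableEq σ] (w : σ → ℕ) (N e : ℕ) (f : MvPolynomial σ ℂ),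
    (∀ d ∈ f.support, Finsupp.weight w d ≤ N) →
      ∃ c : Fin (N + 1) → ℂ,
        MvPolynomial.weightedHomogeneousComponent w e f =
          ∑ j : Fin (N + 1), c j • linSubst σ ℂ (Matrix.diagonal fun i => (((j : ℕ) : ℂ) + 1) ^ (w i)) f := by
  sorry

/-- **Stub 3b — from determinantal expressions to inverse read-outs, polynomially (M/L; provable now).**
A homogeneous `f` of degree `d` with an affine determinantal expression of size `s` is a constant bilinear
read-out `vᵀ B⁻¹ w` of an affine matrix `B` with `det B = 1` of size `≤ 2 (s+1)^9` (tree `HasInvRepr`,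
VPDeterminantalQPProofs.lean). Proof plan: `f = 0` ⇒ `HasInvRepr.zero`; `d = 0` ⇒ `f = C c`,
`HasInvRepr.of_totalDegree_le_one`; `d ≥ 1` ⇒ the PROVED tree theorem
`IkenmeyerLandsberg2017_powTrace_of_detRepr_holds` gives an `N × N` matrix `A` of linear forms with
`tr(A^d) = f`, `N + 1 ≤ (d+1)·((s³-s)/3+2)`; the layered branching program `B := 1 - E` on `Fin (d+1) × Fin N`,
`E ((ℓ,a),(ℓ+1,b)) = A a b`, is block unitriangular (`Matrix.BlockTriangular`, `Matrix.det_of_upperTriangular` /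
`BlockTriangular.det`), so `det B = 1`, and `B⁻¹ = Σ_{k ≤ d} E^k` has `((0,i),(d,i))` entry `(A^d) i i`, whence
`HasInvRepr ((A^d) i i) ((d+1) N)`; sum over `i` (`HasInvRepr.finset_sum`): `HasInvRepr (tr A^d) ((d+1) N²)`;
finally `d ≤ s` (`IsHomogeneous.totalDegree`, `totalDegree_le_of_hasDetRepr_holds`) and `(s³-s)/3+2 ≤ (s+1)³`
(`s ≥ 1`) give `(d+1) N² ≤ (s+1)^9`. Sources: IkenmeyerLandsberg2017 Thm 4.1/Rem 4.5; Valiant1979;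
BurgisserClausenShokrollahi1997 Thm (21.27); MahajanVinay1997. -/
theorem stub_invReprOfDetRepr : ∀ (σ : Type) [Fintype σ] [DecidableEq σ] (f : MvPolynomial σ ℂ) (d s : ℕ),
    f.IsHomogeneous d → HasDetRepr f s → HasInvRepr f (2 * (s + 1) ^ 9) := by
  sorry

/-- **Stub 4 — de-padding is a projection (S in mathematics, M in Lean; provable now).** For `n ≤ m`, an
affine determinantal expression of the padded permanent `X₀₀^(m-n) per_n` (in the `m²` variables) of size `s`
yields one of `per_n` (in its own `n²` variables) of the same size: substitute `X₀₀ ↦ 1`, block variable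
`(i, j) ↦ X_(i-(m-n), j-(m-n))`, every other variable `↦ 0` — variables or constants, i.e. `perPoly (Fin n) ℂ`
is a Valiant PROJECTION of `paddedPerPoly ℂ n m` (`IsProjection`), and determinantal expressions are stable under
projection (`HasDetRepr.of_isProjection_holds`, tree). The image of `paddedPerPoly` is computed from its
definition (`X (0,0) ^ (m-n) * rename (BlockIdx-embedding) (perPoly (BlockIdx n m) ℂ)`; `aeval_rename`,
`perPoly` transported along `BlockIdx n m ≃ Fin n`, `card_blockIdx`; for `n = m` the padding exponent is `0` and
`(0,0)` is a block variable; for `n < m`, `(0,0)` is not in the block). Leans on: `paddedPerPoly`, `BlockIdx`,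
`card_blockIdx`, `perPoly`, `Matrix.mvPolynomialX`, `Matrix.permanent`, `MvPolynomial.aeval_rename`,
`HasDetRepr.of_isProjection_holds`, `IsProjection`. -/
theorem stub_unpad : ∀ (n m : ℕ) [NeZero m], n ≤ m → ∀ s : ℕ,
    HasDetRepr (paddedPerPoly ℂ n m) s → HasDetRepr (perPoly (Fin n) ℂ) s := by
  sorry

/-- **Stub 5 — EXTERNAL hardness input: eventual super-quasi-polynomial affine determinantal
complexity of the permanent (open problem; NOT to be attempted inside this line).** For every `c`,
`dc(per_n) > 2^((log₂ n + c)^c)` for all large `n`. This is the EVENTUAL form of route DetQP's thesis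
`DetQP.DetqpThesis = ¬ IsQPBounded (n ↦ dc(per_n))` (stmt-ValiantsHypothesis-0315, infinitely-often
form, which is logically insufficient here: `¬X` only yields witnesses for infinitely many `n`); it is
strictly WEAKER than the crux X (given `WitnessToMembership` + MS Prop 4.4: `dc ≥ border-dc`), and it
implies VH on its own through the proved `DetQP.DcqpToVH` — so this line ISOLATES the border phenomenon
(stubs 1–4: "border + fixedness add at most a quasi-polynomial factor") and delegates the hardness of
the permanent to the affine routes (DetQP, UlrichPadded, PrincipalMinorColouring, GrenetZeon, …), as all
three triagers recorded ("fine for the crux, moot for the summit"). Recommended: the tenure planner files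
it as a shared support item `DcPerEventuallySuperQP` (rank 9) of BorderApolarity/DetQP; the lead should
brief NO stub-worker on it. Known: `n²/2 ≤ dc(per_n) ≤ 2ⁿ - 1` (MignonRessayre2004, Grenet2011).
Sources: MignonRessayre2004; Grenet2011; BurgisserClausenShokrollahi1997 (21.41), Problem 21.5;
arXiv:2406.06217 Thm 2.36. -/
theorem stub_dcPerEventuallySuperQP : ∀ c : ℕ, ∃ n₀ : ℕ, ∀ n ≥ n₀,
    2 ^ ((Nat.log 2 n + c) ^ c) < determinantalComplexity (perPoly (Fin n) ℂ) := by
  sorry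

/-! ## Glue (sorry-free): linear substitution, scalars, de-bordering, quasi-polynomial bookkeeping -/

/-- Affine determinantal expressions are stable under linear substitution of the variables: apply the algebra
endomorphism `linSubst A` entrywise (`RingHom.map_det`); affine entries stay affine
(`totalDegree_linSubst_le_holds`). Any square `A`, invertible or not. [folklore] -/
theorem hasDetRepr_linSubst {σ : Type*} [Fintype σ] (A : Matrix σ σ ℂ) {f : MvPolynomial σ ℂ} {s : ℕ}
    (h : HasDetRepr f s) : HasDetRepr (linSubst σ ℂ A f) s := by
  obtain ⟨M, hM1, hMdet⟩ := h
  refine ⟨(linSubst σ ℂ A).toRingHom.mapMatrix M, fun i j => ?_, ?_⟩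
  · exact (totalDegree_linSubst_le_holds A (M i j)).trans (hM1 i j)
  · rw [← RingHom.map_det, hMdet]
    rfl

/-- Inverse read-outs are stable under scalars: scale the read-out vector `v`. [folklore] -/
theorem hasInvRepr_smul {σ : Type*} (c : ℂ) {g : MvPolynomial σ ℂ} {m : ℕ} (h : HasInvRepr g m) :
    HasInvRepr (c • g) m := by
  obtain ⟨ι, _, _, B, v, w, hc, hB, hd, hg⟩ := h
  refine ⟨ι, inferInstance, inferInstance, B, fun i => c * v i, w, hc, hB, hd, ?_⟩
  rw [← hg]
  simp only [dotProduct, map_mul, Finset.smul_sum, MvPolynomial.smul_eq_C_mul, mul_assoc]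

/-- **De-bordering of bounded-weight components** (the planner's `stub_deborder`, now a theorem over
`stub_interp` + `stub_invReprOfDetRepr`, constants `C = 3`, `e₀ = 10`): if `f` is homogeneous of degree `d`
with an affine determinantal expression of size `s` and `w ≤ B` pointwise, then for every square matrix `A` and
every weight `e`, `wHC_w^e (linSubst A f)` has an affine determinantal expression of size `3 ((s+1)(B+1))^10`.
[folklore; Bürgisser 2004 Lemma 5.5(3) in determinantal form] -/
theorem deborder : ∃ C e₀ : ℕ, ∀ (σ : Type) [Fintype σ] [DecidableEq σ] (s B d : ℕ) (w : σ → ℕ)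
    (e : ℕ) (f : MvPolynomial σ ℂ) (A : Matrix σ σ ℂ), f.IsHomogeneous d → HasDetRepr f s →
      (∀ i, w i ≤ B) →
      HasDetRepr (MvPolynomial.weightedHomogeneousComponent w e (linSubst σ ℂ A f))
        (C * ((s + 1) * (B + 1)) ^ e₀) := by
  refine ⟨3, 10, ?_⟩
  intro σ _ _ s B d w e f A hf hdet hw
  -- the translate `g = A · f`: homogeneous of degree `d`, determinantal of size `s`
  have hghom : (linSubst σ ℂ A f).IsHomogeneous d := linSubst_isHomogeneous A hf
  have hgdet : HasDetRepr (linSubst σ ℂ A f) s := hasDetRepr_linSubst A hdet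
  -- weights on its support are at most `s * B`
  have hwt : ∀ α ∈ (linSubst σ ℂ A f).support, Finsupp.weight w α ≤ s * B := by
    intro α hα
    have hne : linSubst σ ℂ A f ≠ 0 := MvPolynomial.ne_zero_iff.mpr ⟨α, MvPolynomial.mem_support_iff.mp hα⟩
    have hdeg : Finsupp.weight (1 : σ → ℕ) α = d := hghom (MvPolynomial.mem_support_iff.mp hα)
    have hw1 : Finsupp.weight (1 : σ → ℕ) α = ∑ i ∈ α.support, α i := by
      rw [Finsupp.weight_apply, Finsupp.sum]
      simp only [Pi.one_apply, smul_eq_mul, mul_one]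
    have hds : d ≤ s := by
      have h1 := hghom.totalDegree hne
      have h2 := totalDegree_le_of_hasDetRepr_holds hgdet
      omega
    calc Finsupp.weight w α = ∑ i ∈ α.support, α i • w i := by
          rw [Finsupp.weight_apply, Finsupp.sum]
      _ ≤ ∑ i ∈ α.support, α i * B := Finset.sum_le_sum fun i _ => by
          rw [smul_eq_mul]; exact Nat.mul_le_mul_left _ (hw i)
      _ = (∑ i ∈ α.support, α i) * B := by rw [Finset.sum_mul]
      _ = d * B := by rw [← hw1, hdeg]
      _ ≤ s * B := Nat.mul_le_mul_right _ hds
  -- interpolation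
  obtain ⟨c, hc⟩ := stub_interp σ w (s * B) e (linSubst σ ℂ A f) hwt
  -- each node is an inverse read-out of size `2 (s+1)^9`
  have hnode : ∀ j : Fin (s * B + 1), HasInvRepr
      (c j • linSubst σ ℂ (Matrix.diagonal fun i => (((j : ℕ) : ℂ) + 1) ^ (w i)) (linSubst σ ℂ A f))
      (2 * (s + 1) ^ 9) := fun j =>
    hasInvRepr_smul (c j) (stub_invReprOfDetRepr σ _ d s (linSubst_isHomogeneous _ hghom)
      (hasDetRepr_linSubst _ hgdet))
  have hsum := HasInvRepr.finset_sum (Finset.univ : Finset (Fin (s * B + 1))) (fun j _ => hnode j)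
  rw [← hc, Finset.card_univ, Fintype.card_fin] at hsum
  refine HasDetRepr.mono_holds hsum.hasDetRepr ?_
  -- `(sB+1) · 2(s+1)^9 + 1 ≤ 3 ((s+1)(B+1))^10`
  have hP : 1 ≤ (s + 1) * (B + 1) := Nat.one_le_iff_ne_zero.mpr (by positivity)
  have h1 : s * B + 1 ≤ (s + 1) * (B + 1) := by nlinarith
  have h2 : (s + 1) ^ 9 ≤ ((s + 1) * (B + 1)) ^ 9 :=
    Nat.pow_le_pow_left (Nat.le_mul_of_pos_right _ (by omega)) 9
  have h3 : 1 ≤ ((s + 1) * (B + 1)) ^ 10 := Nat.one_le_pow _ _ hP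
  calc (s * B + 1) * (2 * (s + 1) ^ 9) + 1
      ≤ (s + 1) * (B + 1) * (2 * ((s + 1) * (B + 1)) ^ 9) + 1 :=
        Nat.add_le_add_right (Nat.mul_le_mul h1 (Nat.mul_le_mul_left 2 h2)) 1
    _ = 2 * ((s + 1) * (B + 1)) ^ 10 + 1 := by ring
    _ ≤ 3 * ((s + 1) * (B + 1)) ^ 10 := by omega

/-- Quasi-polynomial absorption: inside the window `m ≤ 2^((log₂ n + c)^c)` the de-bordered size
`C · ((m+1) · (2^((log₂ m + c₁)^c₁) + 1))^e₀` is again quasi-polynomial in `n`, with the explicit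
exponent `c' = 4 d (d+1)`, `d = c + c₁ + C + e₀ + 2`. [folklore] -/
theorem qp_absorb (c c₁ C e₀ : ℕ) : ∃ c' : ℕ, ∀ n m : ℕ,
    m ≤ 2 ^ ((Nat.log 2 n + c) ^ c) →
      C * ((m + 1) * (2 ^ ((Nat.log 2 m + c₁) ^ c₁) + 1)) ^ e₀ ≤ 2 ^ ((Nat.log 2 n + c') ^ c') := by
  obtain ⟨d, hd_def⟩ : ∃ d : ℕ, d = c + c₁ + C + e₀ + 2 := ⟨_, rfl⟩
  refine ⟨4 * ((d + 1) * d), fun n m hm => ?_⟩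
  generalize hL : Nat.log 2 n = L at hm ⊢
  have hd2 : 2 ≤ d := by omega
  obtain ⟨b, hb_def⟩ : ∃ b : ℕ, b = L + d := ⟨_, rfl⟩
  have hb2 : 2 ≤ b := by omega
  -- (i) the window exponent is dominated by `b ^ d`
  have h1 : (L + c) ^ c ≤ b ^ d :=
    calc (L + c) ^ c ≤ b ^ c := Nat.pow_le_pow_left (by omega) c
      _ ≤ b ^ d := Nat.pow_le_pow_right (by omega) (by omega)
  -- (ii) so is `log₂ m`
  have h2 : Nat.log 2 m ≤ b ^ d :=
    calc Nat.log 2 m ≤ Nat.log 2 (2 ^ ((L + c) ^ c)) := Nat.log_mono_right hm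
      _ = (L + c) ^ c := Nat.log_pow (by norm_num) _
      _ ≤ b ^ d := h1
  have hdb : d ≤ b ^ d :=
    calc d ≤ b := by omega
      _ = b ^ 1 := (pow_one b).symm
      _ ≤ b ^ d := Nat.pow_le_pow_right (by omega) (by omega)
  -- the master quantity `U = b ^ ((d+1) d)`
  obtain ⟨U, hU_def⟩ : ∃ U : ℕ, U = b ^ ((d + 1) * d) := ⟨_, rfl⟩
  have h4 : b ^ d ≤ U := by
    rw [hU_def]
    exact Nat.pow_le_pow_right (by omega) (Nat.le_mul_of_pos_left d (by omega))
  -- (iii) the weight exponent is dominated by `U`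
  have h3 : (Nat.log 2 m + c₁) ^ c₁ ≤ U := by
    have hbase : Nat.log 2 m + c₁ ≤ b ^ (d + 1) :=
      calc Nat.log 2 m + c₁ ≤ b ^ d + d := by omega
        _ ≤ b ^ d + b ^ d := by omega
        _ = 2 * b ^ d := by ring
        _ ≤ b * b ^ d := Nat.mul_le_mul_right (b ^ d) hb2
        _ = b ^ (d + 1) := by ring
    calc (Nat.log 2 m + c₁) ^ c₁ ≤ (b ^ (d + 1)) ^ c₁ := Nat.pow_le_pow_left hbase c₁
      _ ≤ (b ^ (d + 1)) ^ d := Nat.pow_le_pow_right (Nat.one_le_pow _ _ (by omega)) (by omega)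
      _ = U := by rw [hU_def, ← pow_mul]
  -- (iv)–(vii) the two factors and their product
  have h5 : m + 1 ≤ 2 ^ (U + 1) := by
    have hmU : m ≤ 2 ^ U := hm.trans (Nat.pow_le_pow_right (by norm_num) (h1.trans h4))
    have h1U : 1 ≤ 2 ^ U := Nat.one_le_two_pow
    calc m + 1 ≤ 2 ^ U + 2 ^ U := Nat.add_le_add hmU h1U
      _ = 2 ^ (U + 1) := by ring
  have h6 : 2 ^ ((Nat.log 2 m + c₁) ^ c₁) + 1 ≤ 2 ^ (U + 1) :=
    calc 2 ^ ((Nat.log 2 m + c₁) ^ c₁) + 1 ≤ 2 ^ U + 2 ^ U :=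
          Nat.add_le_add (Nat.pow_le_pow_right (by norm_num) h3) Nat.one_le_two_pow
      _ = 2 ^ (U + 1) := by ring
  have h7 : (m + 1) * (2 ^ ((Nat.log 2 m + c₁) ^ c₁) + 1) ≤ 2 ^ (2 * U + 2) :=
    calc (m + 1) * (2 ^ ((Nat.log 2 m + c₁) ^ c₁) + 1) ≤ 2 ^ (U + 1) * 2 ^ (U + 1) :=
          Nat.mul_le_mul h5 h6
      _ = 2 ^ (2 * U + 2) := by rw [← pow_add]; ring
  -- (viii)–(ix) the power `e₀` and the constant `C`
  have h8 : ((m + 1) * (2 ^ ((Nat.log 2 m + c₁) ^ c₁) + 1)) ^ e₀ ≤ 2 ^ ((2 * U + 2) * e₀) :=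
    calc ((m + 1) * (2 ^ ((Nat.log 2 m + c₁) ^ c₁) + 1)) ^ e₀ ≤ (2 ^ (2 * U + 2)) ^ e₀ :=
          Nat.pow_le_pow_left h7 e₀
      _ = 2 ^ ((2 * U + 2) * e₀) := by rw [← pow_mul]
  have h9 : C ≤ 2 ^ C := (Nat.lt_two_pow_self).le
  have h10 : C * ((m + 1) * (2 ^ ((Nat.log 2 m + c₁) ^ c₁) + 1)) ^ e₀ ≤
      2 ^ (C + (2 * U + 2) * e₀) :=
    calc C * ((m + 1) * (2 ^ ((Nat.log 2 m + c₁) ^ c₁) + 1)) ^ e₀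
          ≤ 2 ^ C * 2 ^ ((2 * U + 2) * e₀) := Nat.mul_le_mul h9 h8
      _ = 2 ^ (C + (2 * U + 2) * e₀) := by rw [← pow_add]
  -- (x) the exponent is at most `U ^ 4`
  have hU64 : 64 ≤ U := by
    have h6d : 6 ≤ (d + 1) * d := by
      have := Nat.mul_le_mul (show 3 ≤ d + 1 by omega) hd2
      omega
    calc (64 : ℕ) = 2 ^ 6 := by norm_num
      _ ≤ 2 ^ ((d + 1) * d) := Nat.pow_le_pow_right (by norm_num) h6d
      _ ≤ b ^ ((d + 1) * d) := Nat.pow_le_pow_left hb2 _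
      _ = U := by rw [hU_def]
  have hCU : C ≤ U := le_trans (by omega : C ≤ d) (hdb.trans h4)
  have heU : e₀ ≤ U := le_trans (by omega : e₀ ≤ d) (hdb.trans h4)
  have hUU : U ≤ U ^ 2 := Nat.le_self_pow (by norm_num) U
  have h11 : C + (2 * U + 2) * e₀ ≤ U ^ 4 :=
    calc C + (2 * U + 2) * e₀ ≤ U + (2 * U + 2) * U :=
          Nat.add_le_add hCU (Nat.mul_le_mul_left (2 * U + 2) heU)
      _ = 2 * U ^ 2 + 3 * U := by ring
      _ ≤ 2 * U ^ 2 + 3 * U ^ 2 := Nat.add_le_add_left (Nat.mul_le_mul_left 3 hUU) _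
      _ = 5 * U ^ 2 := by ring
      _ ≤ U * U ^ 2 := Nat.mul_le_mul_right (U ^ 2) (by omega)
      _ ≤ U * U ^ 2 * U := Nat.le_mul_of_pos_right _ (by omega)
      _ = U ^ 4 := by ring
  -- (xi) `U ^ 4 = b ^ (4 (d+1) d) ≤ (L + c') ^ c'`
  have h12 : U ^ 4 ≤ (L + 4 * ((d + 1) * d)) ^ (4 * ((d + 1) * d)) := by
    have hdc : d ≤ 4 * ((d + 1) * d) :=
      calc d ≤ (d + 1) * d := Nat.le_mul_of_pos_left d (by omega)
        _ ≤ 4 * ((d + 1) * d) := Nat.le_mul_of_pos_left _ (by norm_num)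
    have hU4 : U ^ 4 = b ^ (4 * ((d + 1) * d)) := by
      rw [hU_def, ← pow_mul]; congr 1; ring
    rw [hU4]
    exact Nat.pow_le_pow_left (by omega) _
  exact h10.trans (Nat.pow_le_pow_right (by norm_num) (h11.trans h12))

/-- **The composition** (concludes the crux BY NAME, sorry-free over the seven stubs): given `c`, take
`c'` from `qp_absorb` and `n₀ := max n₁ 3` with `n₁` from `stub_dcPerEventuallySuperQP c'`; a witness at
`(n, m)` in the window gives, by `stub_toricFace`, `stub_weightBound`, `deborder`, `hasDetRepr_linSubst` and
`stub_unpad`, `dc(per_n) ≤ C ((m+1)(B+1))^e₀ ≤ 2^((log₂ n + c')^c')`, contradicting stub 5. -/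
theorem FixedWitnessObstructionQP_of :
    Summit.ValiantsHypothesis.ValiantsHypothesis.Theses.BorderApolarity.FixedWitnessObstructionQP := by
  obtain ⟨c₁, hW⟩ := stub_weightBound
  obtain ⟨C, e₀, hD⟩ := deborder
  intro c
  obtain ⟨c', hc'⟩ := qp_absorb c c₁ C e₀
  obtain ⟨n₁, hn₁⟩ := stub_dcPerEventuallySuperQP c'
  refine ⟨max n₁ 3, ?_⟩
  intro n hn m inst hnm hm
  have h3 : 3 ≤ n := le_trans (le_max_right _ _) hn
  have hn₁' : n₁ ≤ n := le_trans (le_max_left _ _) hn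
  have hT := @stub_toricFace n m inst h3 hnm
  dsimp only at hT ⊢
  intro hw
  obtain ⟨u, g, w, e, hpp⟩ := hT hw
  obtain ⟨u', g', w', e', hw', hpp'⟩ := @hW n m inst h3 hnm ⟨u, g, w, e, hpp⟩
  have hhom : (detPoly (Fin m) ℂ).IsHomogeneous m := by
    simpa using (detPoly_isHomogeneous (n := Fin m) (k := ℂ))
  have hcomp := hD (Fin m × Fin m) m (2 ^ ((Nat.log 2 m + c₁) ^ c₁)) m w' e' (detPoly (Fin m) ℂ)
    (g' : Matrix (Fin m × Fin m) (Fin m × Fin m) ℂ) hhom (hasDetRepr_detPoly m) hw'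
  have hpad : HasDetRepr (paddedPerPoly ℂ n m)
      (C * ((m + 1) * (2 ^ ((Nat.log 2 m + c₁) ^ c₁) + 1)) ^ e₀) := by
    rw [hpp']
    exact hasDetRepr_linSubst _ hcomp
  have hper := @stub_unpad n m inst hnm _ hpad
  have hdc := determinantalComplexity_le_of_hasDetRepr hper
  have hle := hc' n m hm
  have hlt := hn₁ n hn₁'
  exact (lt_irrefl _ (hlt.trans_le (hdc.trans hle))).elim

/-! ## Stub 1 from the route's crux 3 and the registered socle step (sorry-free) -/

/-- **Stub 1 follows from crux 3 + the socle step** (sorry-free repackaging). Hypothesis `h5779` is the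
route item `ToricFixedPoints` (stmt-ValiantsHypothesis-5779, ideal level) BY NAME; the registered stub `stub_socle` is the
elementary SOCLE STEP (M in mathematics; M/L in Lean: limits of hyperplanes in `S_m`, the
perfect top-degree pairing `act D f = C (Σ_d d! D_d f_d)`, an `m`-th root, a shift of the weights to `ℕ`):
if `J` is the border-apolar limit of the TORIC family `Q_t = u · diag((t+2)^w) · g · det_m` (the
conclusion of `ToricFixedPoints`, verbatim) and `J_k ⊆ Ann_k(pp)` for `k ≤ m` (W5), then
`J_m = lim Ann_m(Q_t) = (u · F_{e_max})^⊥` is a hyperplane inside the hyperplane `Ann_m(pp)`, so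
`pp = λ u · F_{e_max} = (μ u) · wHC_w^{e_max}(g · det_m)`, `μ^m = λ`. The conclusion is the statement of
`stub_toricFace` verbatim: a lead who prefers to lean on the staffed crux 3 proves `hS` (and waits for /
helps with 5779) instead of attacking `stub_toricFace` directly; a refutation of 5779 by an iterated,
non-toric fixed ideal does NOT refute `stub_toricFace` (only its degree-`m` socle matters). -/
theorem toricFace_of_toricFixedPoints
    (h5779 : Summit.ValiantsHypothesis.ValiantsHypothesis.Theses.BorderApolarity.ToricFixedPoints)
    : ∀ (n m : ℕ) [NeZero m], 3 ≤ n → n ≤ m →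
    (let act := fun (D f : MvPolynomial (Fin m × Fin m) ℂ) => ∑ e ∈ D.support, ∑ d ∈ f.support, MvPolynomial.monomial (d - e) (MvPolynomial.coeff e D * MvPolynomial.coeff d f * ∏ i ∈ e.support, (Nat.descFactorial (d i) (e i) : ℂ)); let rk := fun (p : Fin m × Fin m) => (if (m - n ≤ (p.1 : ℕ) ∧ m - n ≤ (p.2 : ℕ)) ∨ p = (0, 0) then 0 else m * m) + ((p.1 : ℕ) * m + (p.2 : ℕ)); (∃ (P : ℕ → MvPolynomial (Fin m × Fin m) ℂ) (J : ℕ → Set (MvPolynomial (Fin m × Fin m) ℂ)), (∀ t : ℕ, P t ∈ Literature.Computability.AlgebraicComplexity.glOrbit (Fin m × Fin m) ℂ (Literature.Computability.AlgebraicComplexity.detPoly (Fin m) ℂ)) ∧ (∀ k ≤ m, ∀ D ∈ J k, ∃ Ds : ℕ → MvPolynomial (Fin m × Fin m) ℂ, (∀ t, (Ds t).IsHomogeneous k ∧ act (Ds t) (P t) = 0) ∧ Filter.Tendsto (fun t => Literature.Computability.AlgebraicComplexity.coeffVec (Ds t)) Filter.atTop (nhds (Literature.Computability.AlgebraicComplexity.coeffVec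 D))) ∧ (∀ k ≤ m, ∀ (D : MvPolynomial (Fin m × Fin m) ℂ) (φ : ℕ → ℕ) (Ds : ℕ → MvPolynomial (Fin m × Fin m) ℂ), StrictMono φ → (∀ t, (Ds t).IsHomogeneous k ∧ act (Ds t) (P (φ t)) = 0) → Filter.Tendsto (fun t => Literature.Computability.AlgebraicComplexity.coeffVec (Ds t)) Filter.atTop (nhds (Literature.Computability.AlgebraicComplexity.coeffVec D)) → D ∈ J k) ∧ (∀ A : Matrix.GeneralLinearGroup (Fin m × Fin m) ℂ, let M : Matrix (Fin m × Fin m) (Fin m × Fin m) ℂ := A; (∀ i j : Fin m × Fin m, M j i ≠ 0 → rk j ≤ rk i) → (∀ i j : Fin m × Fin m, ((m - n ≤ (i.1 : ℕ) ∧ m - n ≤ (i.2 : ℕ)) ∨ i = (0, 0)) → j ≠ i → M j i = 0) → (∀ i k j l : Fin m, m - n ≤ (i : ℕ) → m - n ≤ (k : ℕ) → m - n ≤ (j : ℕ) → m - n ≤ (l : ℕ) → M (i, j) (i, j) * M (k, l) (k, l) = M (i, l) (i, l) * M (k, j) (k, j)) → M (0, 0) (0, 0) ^ (m - n) * ∏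 i ∈ Finset.univ.filter (fun i : Fin m => m - n ≤ (i : ℕ)), M (i, i) (i, i) = 1 → ∀ k ≤ m, ∀ D ∈ J k, Literature.Computability.AlgebraicComplexity.linSubst (Fin m × Fin m) ℂ Mᵀ D ∈ J k) ∧ (∀ k ≤ m, ∀ D ∈ J k, act D (Literature.Computability.AlgebraicComplexity.paddedPerPoly ℂ n m) = 0))) →
      ∃ (u g : Matrix.GeneralLinearGroup (Fin m × Fin m) ℂ) (w : Fin m × Fin m → ℕ) (e : ℕ),
        paddedPerPoly ℂ n m =
          linSubst (Fin m × Fin m) ℂ (u : Matrix (Fin m × Fin m) (Fin m × Fin m) ℂ)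
            (MvPolynomial.weightedHomogeneousComponent w e
              (linSubst (Fin m × Fin m) ℂ (g : Matrix (Fin m × Fin m) (Fin m × Fin m) ℂ) (detPoly (Fin m) ℂ))) := by
  intro n m inst h3 hnm
  have h1 := @h5779 n m inst h3 hnm
  have h2 := @stub_socle n m inst h3 hnm
  dsimp only at h1 h2 ⊢
  rintro ⟨P, J, hW1, hW2, hW3, hW4, hW5⟩
  obtain ⟨u, g, w, hQ⟩ := h1 P J hW1 ⟨hW2, hW3⟩ hW4
  exact h2 J u g w hQ hW5


/-- **The two-layer glue of the route, kernel-checked**: the route's crux 3 `ToricFixedPoints`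
(stmt-ValiantsHypothesis-5779, BY NAME) together with the registered stubs OTHER THAN `stub_toricFace`
(socle, weightBound, interp, invReprOfDetRepr, unpad, external dc) gives the crux — `stub_toricFace` is then
`toricFace_of_toricFixedPoints`. This is the route file's "FixedWitnessObstructionQP ⇐ ToricFixedPoints → …"
plan realised over this line. -/
theorem FixedWitnessObstructionQP_of_toricFixedPoints
    (h5779 : Summit.ValiantsHypothesis.ValiantsHypothesis.Theses.BorderApolarity.ToricFixedPoints) :
    Summit.ValiantsHypothesis.ValiantsHypothesis.Theses.BorderApolarity.FixedWitnessObstructionQP := by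
  obtain ⟨c₁, hW⟩ := stub_weightBound
  obtain ⟨C, e₀, hD⟩ := deborder
  intro c
  obtain ⟨c', hc'⟩ := qp_absorb c c₁ C e₀
  obtain ⟨n₁, hn₁⟩ := stub_dcPerEventuallySuperQP c'
  refine ⟨max n₁ 3, ?_⟩
  intro n hn m inst hnm hm
  have h3 : 3 ≤ n := le_trans (le_max_right _ _) hn
  have hn₁' : n₁ ≤ n := le_trans (le_max_left _ _) hn
  have hT := @toricFace_of_toricFixedPoints h5779 n m inst h3 hnm
  dsimp only at hT ⊢
  intro hw
  obtain ⟨u, g, w, e, hpp⟩ := hT hw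
  obtain ⟨u', g', w', e', hw', hpp'⟩ := @hW n m inst h3 hnm ⟨u, g, w, e, hpp⟩
  have hhom : (detPoly (Fin m) ℂ).IsHomogeneous m := by
    simpa using (detPoly_isHomogeneous (n := Fin m) (k := ℂ))
  have hcomp := hD (Fin m × Fin m) m (2 ^ ((Nat.log 2 m + c₁) ^ c₁)) m w' e' (detPoly (Fin m) ℂ)
    (g' : Matrix (Fin m × Fin m) (Fin m × Fin m) ℂ) hhom (hasDetRepr_detPoly m) hw'
  have hpad : HasDetRepr (paddedPerPoly ℂ n m)
      (C * ((m + 1) * (2 ^ ((Nat.log 2 m + c₁) ^ c₁) + 1)) ^ e₀) := by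
    rw [hpp']
    exact hasDetRepr_linSubst _ hcomp
  have hper := @stub_unpad n m inst hnm _ hpad
  have hdc := determinantalComplexity_le_of_hasDetRepr hper
  have hle := hc' n m hm
  have hlt := hn₁ n hn₁'
  exact (lt_irrefl _ (hlt.trans_le (hdc.trans hle))).elim

end Summit.ValiantsHypothesis.ValiantsHypothesis.Cruxes.FixedWitnessObstructionQP.ToricFaceDebordering
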